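import Literature.AlgebraicTopology.SingularHomology.LocallyFlatComplement
import Mathlib.Geometry.Manifold.SmoothEmbedding
import HarnessLib

/-!
# Homology of the complement of a smoothly embedded closed submanifold below the codimension

A. Kosinski, *Differential Manifolds* (1993), X.1, proof of Prop. (1.1): for a closed submanifold
`S ⊂ M` of codimension `c`, "`H_i(M ∖ S) → H_i M` is an isomorphism for `i < c - 1`" and onto for
`i = c - 1` (there by general position; equivalently by the Thom isomorphism of a tubular
neighbourhood, `H_i(M, M ∖ S) ≅ H_{i-c}(S) = 0` for `i < c`, Milnor–Stasheff 1974 §10 / Bredon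
1993 VI.11). This file PROVES the statement for the image of a SMOOTH EMBEDDING (Mathlib's
`Manifold.IsSmoothEmbedding`: a `Cⁿ` immersion — slice charts in which the map reads `u ↦ (u, 0)`
— which is a topological embedding) of manifolds modelled on `ℝᵐ`, `ℝᵖ`, by feeding the tree's
tubular-neighbourhood-free engine for topologically locally flat closed subsets
(`surjective_injective_map_compl_of_locallyFlat`, `LocallyFlatComplement.lean`: `Hq(X ∖ S) → Hq(X)`
is onto for `q < k` and one-to-one for `q + 1 < k` as soon as `S` is closed and straightened near
each of its points by an open partial homeomorphism `e : X ⇀ F × K`, `z ∈ S ↔ (e z).1 = 0`, with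
`k ≤ dim F`):

* `exists_straightening_of_isSmoothEmbedding` — **smooth embeddings are locally flat, in
  straightening-chart form**: at every point `b y` of the image of a smooth embedding
  `b : S → N` (`S`, `N` charted on `ℝᵐ`, `ℝᵖ`) there is an open partial homeomorphism
  `e : N ⇀ F × ℝᵐ`, `F` the normal complement of the immersion chart (`dim F + m = p`), with
  `b y ∈ e.source` and `z ∈ range b ↔ (e z).1 = 0` on `e.source`. It is the codomain chart `ψ` of
  the immersion structure at `y`, followed by the inverse of its linear isomorphism
  `A : ℝᵐ × F ≃ ℝᵖ` and the swap, restricted to the open set where the `ℝᵐ`-component lies in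
  the target of the domain chart `φ` and to an open `V ⊆ N` with `b⁻¹(V) = φ.source` (which
  exists because `b` is a topological embedding — this is where injectivity "in the large" is
  used): there `ψ ∘ b ∘ φ⁻¹ = A ∘ (·, 0)` straightens `range b`.
* `surjective_injective_map_compl_range_of_isSmoothEmbedding` — hence, if `range b` is closed
  (e.g. `S` compact, `N` Hausdorff: `…_of_compactSpace`) and `m + k ≤ p`, then
  `Hq(N ∖ b(S); M) → Hq(N; M)` is onto for `q < k` and one-to-one for `q + 1 < k`;
* `subsingleton_singularHomology_of_isSmoothEmbedding` — in particular `Hq(N ∖ b(S); M) = 0`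
  forces `Hq(N; M) = 0` for `q < k`; for a closed surface in a `4`-manifold
  (`m = 2`, `p = 4`, `k = 2`, `q = 1`): **`H₁(N ∖ b(S)) = 0 ⇒ H₁(N) = 0`**
  (`subsingleton_singularHomology_one_of_isSmoothEmbedding_two_four`), the first step of the
  homological reading of the hypotheses of McDuff's classification of symplectic `(+1)`-sphere
  pairs in the tree (`Literature.Geometry.Symplectic.mcduff_plusOneSphere_pairDiffeomorph`,
  `Geometry/Symplectic/PlusOneSpherePair.lean`, module docstring: "`H₁(N ∖ S) = 0` … hence
  `H₁(N) = 0`").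

Everything is proved; no definitions, no named facts.

## References

* [Kosinski1993] A. Kosinski, *Differential Manifolds*, Academic Press 1993, X.1 Prop. (1.1).
* [HatcherAT2002] A. Hatcher, *Algebraic Topology*, CUP 2002, §3.3 proof of Thm. 3.35 (the
  induction over open sets behind the engine), §2.1 (functoriality).
* [MilnorStasheff1974] J. Milnor, J. Stasheff, *Characteristic Classes* (1974), §10.
-/

noncomputable section

open CategoryTheory Limits Set Function TopologicalSpace Metric Module
open scoped Manifold ContDiff Topology

universe v

namespace Literature.AlgebraicTopology.SingularHomology

variable (R : Type v) [CommRing R] (M : Type v) [AddCommGroup M] [Module R M]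

/-! ### Smooth embeddings are locally flat (straightening charts) -/

section Straightening

variable {m p : ℕ} {S N : Type} [TopologicalSpace S] [ChartedSpace (EuclideanSpace ℝ (Fin m)) S]
  [TopologicalSpace N] [ChartedSpace (EuclideanSpace ℝ (Fin p)) N] {n : ℕ∞ω} {b : S → N}

omit R M in
/-- **Smooth embeddings are locally flat (straightening charts).** If `b : S → N` is a smooth
embedding of manifolds charted on `ℝᵐ`, `ℝᵖ` (a `Cⁿ` immersion that is a topological embedding),
then at every point of its image there is an open partial homeomorphism `e : N ⇀ F × ℝᵐ` onto an
open subset of a product, `F` finite-dimensional with `dim F + m = p`, whose source contains the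
point and on whose source `z ∈ range b ↔ (e z).1 = 0`. (Kosinski 1993, II.2: a submanifold has
slice charts; here read off Mathlib's immersion charts and the embedding property.)
[cite: Kosinski1993, X.1 Prop. (1.1)] -/
theorem exists_straightening_of_isSmoothEmbedding
    (hb : Manifold.IsSmoothEmbedding (𝓡 m) (𝓡 p) n b) (y : S) :
    ∃ (F : Type) (_ : NormedAddCommGroup F) (_ : NormedSpace ℝ F) (_ : FiniteDimensional ℝ F)
      (e : OpenPartialHomeomorph N (F × EuclideanSpace ℝ (Fin m))),
      Module.finrank ℝ F + m = p ∧ b y ∈ e.source ∧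
        ∀ z ∈ e.source, z ∈ range b ↔ (e z).1 = 0 := by
  -- the immersion structure at `y`: charts `φ`, `ψ` and the linear isomorphism `A`
  have hat : Manifold.IsImmersionAt (𝓡 m) (𝓡 p) n b y := hb.isImmersion.isImmersionAt y
  set F : Type := hat.complement with hF
  have h : Manifold.IsImmersionAtOfComplement F (𝓡 m) (𝓡 p) n b y :=
    hat.isImmersionAtOfComplement_complement
  set φ : OpenPartialHomeomorph S (EuclideanSpace ℝ (Fin m)) := h.domChart with hφ
  set ψ : OpenPartialHomeomorph N (EuclideanSpace ℝ (Fin p)) := h.codChart with hψ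
  set A : (EuclideanSpace ℝ (Fin m) × F) ≃L[ℝ] EuclideanSpace ℝ (Fin p) := h.equiv with hA
  have hyφ : y ∈ φ.source := h.mem_domChart_source
  have hbyψ : b y ∈ ψ.source := h.mem_codChart_source
  have hsrc : φ.source ⊆ b ⁻¹' ψ.source := h.source_subset_preimage_source
  -- the chart expression: `ψ (b (φ⁻¹ u)) = A (u, 0)` for `u ∈ φ.target`
  have hw : ∀ u ∈ φ.target, ψ (b (φ.symm u)) = A (u, 0) := by
    intro u hu
    have hu' : u ∈ (φ.extend (𝓡 m)).target := by
      rw [OpenPartialHomeomorph.extend_target]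
      simpa using hu
    have := h.writtenInCharts hu'
    simpa [OpenPartialHomeomorph.extend_coe, OpenPartialHomeomorph.extend_coe_symm] using this
  -- `F` is finite-dimensional of dimension `p - m`
  haveI : FiniteDimensional ℝ F :=
    Module.Finite.of_injective
      (((A : (EuclideanSpace ℝ (Fin m) × F) →L[ℝ] EuclideanSpace ℝ (Fin p)) :
          (EuclideanSpace ℝ (Fin m) × F) →ₗ[ℝ] EuclideanSpace ℝ (Fin p)).comp
        (LinearMap.inr ℝ (EuclideanSpace ℝ (Fin m)) F))
      (fun v w hvw => LinearMap.inr_injective (A.injective hvw))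
  have hdim : Module.finrank ℝ F + m = p := by
    have h1 := A.toLinearEquiv.finrank_eq
    rw [Module.finrank_prod, finrank_euclideanSpace_fin, finrank_euclideanSpace_fin] at h1
    omega
  -- an open `V ⊆ N` with `b ⁻¹' V = φ.source` (topological embedding)
  obtain ⟨V, hV, hbV⟩ := hb.isEmbedding.isInducing.isOpen_iff.1 φ.open_source
  -- the open set where the `ℝᵐ`-component of `A⁻¹ ∘ ψ` lies in `φ.target`
  set U : Set (EuclideanSpace ℝ (Fin p)) := A.symm ⁻¹' (Prod.fst ⁻¹' φ.target) with hU
  have hUo : IsOpen U :=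
    (φ.open_target.preimage continuous_fst).preimage A.symm.continuous
  set s : Set N := (ψ.source ∩ ψ ⁻¹' U) ∩ V with hs
  have hso : IsOpen s := (ψ.isOpen_inter_preimage hUo).inter hV
  -- the straightening chart
  let T : EuclideanSpace ℝ (Fin p) ≃ₜ F × EuclideanSpace ℝ (Fin m) :=
    A.symm.toHomeomorph.trans (Homeomorph.prodComm _ _)
  let e : OpenPartialHomeomorph N (F × EuclideanSpace ℝ (Fin m)) :=
    (ψ.restrOpen s hso).transHomeomorph T
  have he_source : e.source = ψ.source ∩ s := by
    simp [e]
  have he_apply : ∀ z, e z = ((A.symm (ψ z)).2, (A.symm (ψ z)).1) := fun z => rfl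
  refine ⟨F, inferInstance, inferInstance, inferInstance, e, hdim, ?_, fun z hz => ?_⟩
  · -- `b y ∈ e.source`
    rw [he_source]
    refine ⟨hbyψ, ⟨⟨hbyψ, ?_⟩, ?_⟩⟩
    · -- `(A⁻¹ (ψ (b y))).1 = φ y ∈ φ.target`
      have h1 : ψ (b y) = A (φ y, 0) := by
        have := hw (φ y) (φ.map_source hyφ)
        rwa [φ.left_inv hyφ] at this
      show A.symm (ψ (b y)) ∈ Prod.fst ⁻¹' φ.target
      rw [h1, A.symm_apply_apply]
      exact φ.map_source hyφ
    · show b y ∈ V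
      have : y ∈ b ⁻¹' V := by rw [hbV]; exact hyφ
      exact this
  · rw [he_source] at hz
    obtain ⟨hzψ, ⟨-, hzU⟩, hzV⟩ := hz
    have hu : (A.symm (ψ z)).1 ∈ φ.target := hzU
    rw [he_apply]
    constructor
    · -- points of `range b` in `V` come from `φ.source`, where the chart expression applies
      rintro ⟨t, rfl⟩
      have ht : t ∈ φ.source := by rw [← hbV]; exact hzV
      have h1 : ψ (b t) = A (φ t, 0) := by
        have := hw (φ t) (φ.map_source ht)
        rwa [φ.left_inv ht] at this
      show (A.symm (ψ (b t))).2 = 0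
      rw [h1, A.symm_apply_apply]
    · intro h0
      set u := (A.symm (ψ z)).1 with hu'
      have h1 : A.symm (ψ z) = (u, 0) := Prod.ext rfl h0
      have h2 : ψ z = A (u, 0) := by
        rw [← h1, A.apply_symm_apply]
      have h3 : ψ z = ψ (b (φ.symm u)) := by rw [h2, hw u hu]
      have h4 : b (φ.symm u) ∈ ψ.source := hsrc (φ.map_target hu)
      exact ⟨φ.symm u, (ψ.injOn hzψ h4 h3).symm⟩

end Straightening

/-! ### Homology of the complement below the codimension -/

section Complement

variable {m p : ℕ} {S N : Type} [TopologicalSpace S] [ChartedSpace (EuclideanSpace ℝ (Fin m)) S]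
  [TopologicalSpace N] [ChartedSpace (EuclideanSpace ℝ (Fin p)) N] {n : ℕ∞ω} {b : S → N}

/-- **Homology of the complement of a smoothly embedded closed submanifold below the
codimension** (Kosinski 1993, X.1, proof of Prop. (1.1)): if `b : S → N` is a smooth embedding of
manifolds charted on `ℝᵐ`, `ℝᵖ` with closed image, `N` second countable and `m + k ≤ p`, then
`Hq(N ∖ b(S); M) → Hq(N; M)` is onto for `q < k` and one-to-one for `q + 1 < k`.
[cite: Kosinski1993, X.1 Prop. (1.1)] -/
theorem surjective_injective_map_compl_range_of_isSmoothEmbedding [SecondCountableTopology N]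
    (hb : Manifold.IsSmoothEmbedding (𝓡 m) (𝓡 p) n b) (hcl : IsClosed (range b)) (k : ℕ)
    (hk : m + k ≤ p) :
    (∀ q, q < k → Function.Surjective (singularHomology.map R M (subsetIncl (range b)ᶜ) q)) ∧
      ∀ q, q + 1 < k → Function.Injective (singularHomology.map R M (subsetIncl (range b)ᶜ) q) := by
  refine surjective_injective_map_compl_of_locallyFlat R M hcl k ?_
  rintro x ⟨y, rfl⟩
  obtain ⟨F, _, _, _, e, hdim, hye, he⟩ := exists_straightening_of_isSmoothEmbedding hb y
  exact ⟨F, inferInstance, inferInstance, inferInstance, EuclideanSpace ℝ (Fin m), inferInstance,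
    inferInstance, e, by omega, hye, he⟩

/-- The same for a compact source and a Hausdorff target (the image is then closed).
[cite: Kosinski1993, X.1 Prop. (1.1)] -/
theorem surjective_injective_map_compl_range_of_isSmoothEmbedding_of_compactSpace
    [SecondCountableTopology N] [T2Space N] [CompactSpace S]
    (hb : Manifold.IsSmoothEmbedding (𝓡 m) (𝓡 p) n b) (k : ℕ) (hk : m + k ≤ p) :
    (∀ q, q < k → Function.Surjective (singularHomology.map R M (subsetIncl (range b)ᶜ) q)) ∧
      ∀ q, q + 1 < k → Function.Injective (singularHomology.map R M (subsetIncl (range b)ᶜ) q) :=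
  surjective_injective_map_compl_range_of_isSmoothEmbedding R M hb
    (isCompact_range hb.isEmbedding.continuous).isClosed k hk

/-- **`Hq(N ∖ b(S); M) = 0` forces `Hq(N; M) = 0` below the codimension** (`q < k`,
`m + k ≤ p`, closed image). [cite: Kosinski1993, X.1 Prop. (1.1)] -/
theorem subsingleton_singularHomology_of_isSmoothEmbedding [SecondCountableTopology N]
    (hb : Manifold.IsSmoothEmbedding (𝓡 m) (𝓡 p) n b) (hcl : IsClosed (range b)) {k q : ℕ}
    (hk : m + k ≤ p) (hq : q < k)
    [Subsingleton (singularHomology R M (↥((range b)ᶜ)) q)] :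
    Subsingleton (singularHomology R M N q) :=
  ((surjective_injective_map_compl_range_of_isSmoothEmbedding R M hb hcl k hk).1 q hq).subsingleton

/-- **A closed surface in a `4`-manifold: `H₁(N ∖ b(S)) = 0 ⇒ H₁(N) = 0`** (codimension `2`,
degree `1`; compact `S`, Hausdorff second countable `N`). This is the first step of the
homological reading of the hypotheses of McDuff's classification of symplectic `(+1)`-sphere pairs
as vendored in the tree (`Literature.Geometry.Symplectic.mcduff_plusOneSphere_pairDiffeomorph`).
[cite: Kosinski1993, X.1 Prop. (1.1)] -/
theorem subsingleton_singularHomology_one_of_isSmoothEmbedding_two_four {S N : Type}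
    [TopologicalSpace S] [ChartedSpace (EuclideanSpace ℝ (Fin 2)) S] [CompactSpace S]
    [TopologicalSpace N] [ChartedSpace (EuclideanSpace ℝ (Fin 4)) N] [T2Space N]
    [SecondCountableTopology N] {n : ℕ∞ω} {b : S → N}
    (hb : Manifold.IsSmoothEmbedding (𝓡 2) (𝓡 4) n b)
    [Subsingleton (singularHomology R M (↥((range b)ᶜ)) 1)] :
    Subsingleton (singularHomology R M N 1) :=
  subsingleton_singularHomology_of_isSmoothEmbedding R M hb
    (isCompact_range hb.isEmbedding.continuous).isClosed (k := 2) le_rfl one_lt_two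

end Complement

end Literature.AlgebraicTopology.SingularHomology
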